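import Summits.QuantumAdvantage.QuantumAdvantage.Theorems.OddPrimeWalkClassBlind
import Literature.Computability.MetaComplexity.TwoModuliExpSums
import Mathlib.Analysis.SpecialFunctions.Trigonometric.Bounds

/-!
# Signature classes of few linear forms mod `5` are balanced mod `3` (engine for item stmt-QuantumAdvantage-24150 `FewFormsPairLaw`)

Cell qa-qnc0, route OddPrimeWalk (support, rank 9); planner qa-qnc0-p2 g30 (ROUND-30 §3.9, THM 30-E, engine (ZS-bal));
prover qn-prover-3 g19.

SETTING.  `s` linear forms `α : Fin s → Fin n → ℤ/5`; the mod-`5` SIGNATURE of an `A`-part `v` (bits `< m`) is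
`sigA α m v = (Σ_{i<m, vᵢ} α k i)_k ∈ (ℤ/5)^s`, and of a `B`-part `x` (bits `≥ m`) `sigB β m x = (Σ_{i≥m, xᵢ} β k i)_k`.
With the cells of `OddPrimeWalkClassBlind` (`cellA m (sigA α m) σ a` = `A`-parts of signature `σ` and weight `≡ a (mod 3)`):

* `three_mul_card_cellA_ge` (§3): for EVERY signature `σ` and residue `a`,
  `#{v ∈ Aset : sigA v = σ} − 2(2cos(π/15))^m ≤ 3·#cellA σ a` — the weight mod `3` is almost uniform on every signature
  class, uniformly in the class.  This is the tree's two-moduli exponential-sum bound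
  `TwoModuli.abs_three_mul_card_cell_sub_card_le` (cells of `K` forms mod `p` × weight mod `3`, [Bourgain 2005, (10)] /
  [Chattopadhyay–Wigderson 2009, Lemma 5]) transported from the cube `{0,1}^m` to the `A`-parts (§2).
* `balanceA_ge` (§4): `(2^m − 5^s·2(2cos(π/15))^m)/3 ≤ Σ_σ minCellA σ`; `balanceB_ge` symmetrically with `n − m`.
* §5 numerics: `cos(π/15) ≤ 223/225` (from `Real.cos_le_one_sub_mul_cos_sq`, no decimal expansion of `π`),
  `(223/225)^80 ≤ 1/2`, hence `5^s·2(2cos(π/15))^L ≤ 2^L/4` once `240(s+1) ≤ L` (`five_pow_mul_err_le`), and the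
  BALANCE BOUNDS `2^m/4 ≤ Σ_σ minCellA σ`, `2^(n−m)/4 ≤ Σ_σ minCellB σ` (`balanceA_ge_quarter`, `balanceB_ge_quarter`).
(The planner's (ZS-bal) reaches `L ≥ 37s + 73` by a second moment; the pointwise bound used here needs no Cauchy–Schwarz and
the constants are immaterial for the item.)
WHAT THIS IS NOT: instrument; separation NOT moved.
-/

namespace Summit.QuantumAdvantage.AdviceFreeQNC0.OddConfig

open Finset Classical Literature.Computability.MetaComplexity

variable {n : ℕ}

/-! ### §1 The mod-5 signatures of the two halves -/

/-- the mod-`5` signature of the `A`-part (bits `< m`) under the listed forms `α`. -/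
def sigA {s : ℕ} (α : Fin s → Fin n → ZMod 5) (m : ℕ) (v : Fin n → Bool) : Fin s → ZMod 5 :=
  fun k => ∑ i : Fin n, if i.val < m ∧ v i = true then α k i else 0

/-- the mod-`5` signature of the `B`-part (bits `≥ m`) under the listed forms `β`. -/
def sigB {s : ℕ} (β : Fin s → Fin n → ZMod 5) (m : ℕ) (x : Fin n → Bool) : Fin s → ZMod 5 :=
  fun k => ∑ i : Fin n, if m ≤ i.val ∧ x i = true then β k i else 0

/-! ### §2 Transport of signature cells to the cubes `{0,1}^m` and `{0,1}^(n-m)` -/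

section Transport

variable {m s : ℕ}

/-- a sum over `Fin n` supported below `m`, reindexed by `Fin m`. -/
theorem sum_ite_lt_eq (hm : m ≤ n) {M : Type*} [AddCommMonoid M] (P : Fin n → Prop) [DecidablePred P] (f : Fin n → M) :
    (∑ i : Fin n, if i.val < m ∧ P i then f i else 0)
      = ∑ j : Fin m, if P (Fin.castLE hm j) then f (Fin.castLE hm j) else 0 := by
  have hmap : (∑ j : Fin m, if P (Fin.castLE hm j) then f (Fin.castLE hm j) else 0)
      = ∑ i ∈ (univ : Finset (Fin m)).map (Fin.castLEEmb hm), if i.val < m ∧ P i then f i else 0 := by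
    rw [sum_map]
    refine sum_congr rfl fun j _ => ?_
    have hj : (Fin.castLEEmb hm j).val < m := j.isLt
    simp only [hj, true_and]
    rfl
  rw [hmap]
  symm
  refine sum_subset (subset_univ _) fun i _ hi => ?_
  have hlt : ¬ i.val < m := fun h => hi (mem_map.mpr ⟨⟨i.val, h⟩, mem_univ _, Fin.ext rfl⟩)
  simp [hlt]

/-- the far reindexing map `j ↦ m + j`. -/
def farIdx (hm : m ≤ n) : Fin (n - m) ↪ Fin n :=
  ⟨fun j => ⟨m + j.val, by have := j.isLt; omega⟩, fun j j' h => by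
    have := congrArg Fin.val h; exact Fin.ext (by simp only at this; omega)⟩

/-- a sum over `Fin n` supported from `m` on, reindexed by `Fin (n - m)`. -/
theorem sum_ite_ge_eq (hm : m ≤ n) {M : Type*} [AddCommMonoid M] (P : Fin n → Prop) [DecidablePred P] (f : Fin n → M) :
    (∑ i : Fin n, if m ≤ i.val ∧ P i then f i else 0)
      = ∑ j : Fin (n - m), if P (farIdx hm j) then f (farIdx hm j) else 0 := by
  have hmap : (∑ j : Fin (n - m), if P (farIdx hm j) then f (farIdx hm j) else 0)
      = ∑ i ∈ (univ : Finset (Fin (n - m))).map (farIdx hm), if m ≤ i.val ∧ P i then f i else 0 := by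
    rw [sum_map]
    refine sum_congr rfl fun j _ => ?_
    have hj : m ≤ (farIdx hm j).val := by simp [farIdx]
    simp only [hj, true_and]
  rw [hmap]
  symm
  refine sum_subset (subset_univ _) fun i _ hi => ?_
  have hge : ¬ m ≤ i.val := fun h =>
    hi (mem_map.mpr ⟨⟨i.val - m, by have := i.isLt; omega⟩, mem_univ _, Fin.ext (by simp [farIdx]; omega)⟩)
  simp [hge]

/-- the `A`-signature read on the near cube. -/
theorem sigA_eq_sum_resA (hm : m ≤ n) (α : Fin s → Fin n → ZMod 5) (v : Fin n → Bool) (k : Fin s) :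
    sigA α m v k = ∑ j : Fin m, if resA hm v j = true then α k (Fin.castLE hm j) else 0 := by
  unfold sigA resA
  exact sum_ite_lt_eq hm (fun i => v i = true) (α k)

/-- the `B`-signature read on the far cube. -/
theorem sigB_eq_sum_resB (hm : m ≤ n) (β : Fin s → Fin n → ZMod 5) (x : Fin n → Bool) (k : Fin s) :
    sigB β m x k = ∑ j : Fin (n - m), if resB m x j = true then β k (farIdx hm j) else 0 := by
  unfold sigB
  rw [sum_ite_ge_eq hm (fun i => x i = true) (β k)]
  rfl

/-- **transport of `A`-signature classes (with any weight condition) to the near cube.** -/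
theorem card_filter_Aset_sigA (hm : m ≤ n) (α : Fin s → Fin n → ZMod 5) (σ : Fin s → ZMod 5)
    (P : ℕ → Prop) [DecidablePred P] :
    ((Aset n m).filter fun v => sigA α m v = σ ∧ P (wtA m v)).card =
      (univ.filter fun z : Fin m → Bool =>
        (fun k => ∑ j : Fin m, if z j = true then α k (Fin.castLE hm j) else 0) = σ ∧ P (wt z)).card := by
  refine card_nbij' (resA hm) (extA m) ?_ ?_ ?_ ?_
  · intro v hv
    obtain ⟨_, hsig, hP⟩ := mem_filter.mp (mem_coe.mp hv)
    refine mem_coe.mpr (mem_filter.mpr ⟨mem_univ _, ?_, by rwa [wt_resA]⟩)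
    funext k; rw [← sigA_eq_sum_resA hm α v k, hsig]
  · intro z hz
    obtain ⟨_, hsig, hP⟩ := mem_filter.mp (mem_coe.mp hz)
    refine mem_coe.mpr (mem_filter.mpr ⟨extA_mem_Aset z, ?_, by rwa [← wt_resA hm, resA_extA]⟩)
    funext k; rw [sigA_eq_sum_resA hm, resA_extA]; exact congrFun hsig k
  · intro v hv; exact extA_resA hm (mem_filter.mp (mem_coe.mp hv)).1
  · intro z _; exact resA_extA hm z

/-- **transport of `B`-signature classes (with any weight condition) to the far cube.** -/
theorem card_filter_Bset_sigB (hm : m ≤ n) (β : Fin s → Fin n → ZMod 5) (σ : Fin s → ZMod 5)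
    (P : ℕ → Prop) [DecidablePred P] :
    ((Bset n m).filter fun x => sigB β m x = σ ∧ P (wtB m x)).card =
      (univ.filter fun z : Fin (n - m) → Bool =>
        (fun k => ∑ j : Fin (n - m), if z j = true then β k (farIdx hm j) else 0) = σ ∧ P (wt z)).card := by
  refine card_nbij' (resB m) (extB m) ?_ ?_ ?_ ?_
  · intro x hx
    obtain ⟨_, hsig, hP⟩ := mem_filter.mp (mem_coe.mp hx)
    refine mem_coe.mpr (mem_filter.mpr ⟨mem_univ _, ?_, by rwa [wt_resB hm]⟩)
    funext k; rw [← sigB_eq_sum_resB hm β x k, hsig]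
  · intro z hz
    obtain ⟨_, hsig, hP⟩ := mem_filter.mp (mem_coe.mp hz)
    refine mem_coe.mpr (mem_filter.mpr ⟨extB_mem_Bset z, ?_, by rwa [← wt_resB hm, resB_extB]⟩)
    funext k; rw [sigB_eq_sum_resB hm, resB_extB]; exact congrFun hsig k
  · intro x hx; exact extB_resB (mem_filter.mp (mem_coe.mp hx)).1
  · intro z _; exact resB_extB z

/-- `|Aset n m| = 2^m`. -/
theorem card_Aset (hm : m ≤ n) : (Aset n m).card = 2 ^ m := by
  have h : (Aset n m).card = (univ : Finset (Fin m → Bool)).card := by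
    refine card_nbij' (resA hm) (extA m) (fun v _ => mem_coe.mpr (mem_univ _))
      (fun z _ => mem_coe.mpr (extA_mem_Aset z)) ?_ ?_
    · intro v hv; exact extA_resA hm (mem_coe.mp hv)
    · intro z _; exact resA_extA hm z
  rw [h, card_univ, Fintype.card_fun, Fintype.card_bool, Fintype.card_fin]

/-- `|Bset n m| = 2^(n-m)`. -/
theorem card_Bset (m : ℕ) : (Bset n m).card = 2 ^ (n - m) := by
  have h : (Bset n m).card = (univ : Finset (Fin (n - m) → Bool)).card := by
    refine card_nbij' (resB m) (extB m) (fun x _ => mem_coe.mpr (mem_univ _))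
      (fun z _ => mem_coe.mpr (extB_mem_Bset z)) ?_ ?_
    · intro x hx; exact extB_resB (mem_coe.mp hx)
    · intro z _; exact resB_extB z
  rw [h, card_univ, Fintype.card_fun, Fintype.card_bool, Fintype.card_fin]

end Transport

/-! ### §3 Every signature class is almost uniformly split among the three weight classes -/

section PerClass

variable {m s : ℕ}

/-- the residue condition in `ℕ` and in `ZMod 3` agree. -/
theorem mod_three_eq_iff_cast (w : ℕ) {a : ℕ} (ha : a < 3) : w % 3 = a ↔ (w : ZMod 3) = (a : ZMod 3) := by
  rw [ZMod.natCast_eq_natCast_iff', Nat.mod_eq_of_lt ha]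

/-- the numerical form of the two-moduli error term at `p = 5`. -/
theorem two_cos_fifteen_eq : (2 * Real.cos (Real.pi / (3 * ((5 : ℕ) : ℝ)))) = 2 * Real.cos (Real.pi / 15) := by
  norm_num

/-- **Alice side**: `#{v ∈ Aset : sigA v = σ} − 2(2cos(π/15))^m ≤ 3·#cellA σ a` for every `σ` and every `a < 3`. -/
theorem three_mul_card_cellA_ge (hm : m ≤ n) (α : Fin s → Fin n → ZMod 5) (σ : Fin s → ZMod 5) {a : ℕ} (ha : a < 3) :
    (((Aset n m).filter fun v => sigA α m v = σ).card : ℝ) - 2 * (2 * Real.cos (Real.pi / 15)) ^ m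
      ≤ 3 * ((cellA m (sigA α m) σ a).card : ℝ) := by
  have hcell : (cellA m (sigA α m) σ a).card = (univ.filter fun z : Fin m → Bool =>
      ((univ.filter fun j => z j = true).card : ZMod 3) = (a : ZMod 3) ∧
      (fun k => ∑ j : Fin m, if z j = true then α k (Fin.castLE hm j) else 0) = σ).card := by
    have h := card_filter_Aset_sigA hm α σ (fun w => w % 3 = a)
    have e1 : cellA m (sigA α m) σ a = (Aset n m).filter fun v => sigA α m v = σ ∧ wtA m v % 3 = a := by
      ext v; simp [cellA]
    rw [e1, h]
    refine congrArg Finset.card (filter_congr fun z _ => ?_)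
    rw [and_comm, wt, mod_three_eq_iff_cast _ ha]
  have hcls : ((Aset n m).filter fun v => sigA α m v = σ).card = (univ.filter fun z : Fin m → Bool =>
      (fun k => ∑ j : Fin m, if z j = true then α k (Fin.castLE hm j) else 0) = σ).card := by
    have h := card_filter_Aset_sigA hm α σ (fun _ => True)
    simp only [and_true] at h
    exact h
  have hlit := TwoModuli.abs_three_mul_card_cell_sub_card_le (ι := Fin m) (p := 5) (K := s) (by norm_num)
    (fun k j => α k (Fin.castLE hm j)) σ (a : ZMod 3)
  rw [two_cos_fifteen_eq, Fintype.card_fin, ← hcell, ← hcls] at hlit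
  linarith [(abs_le.mp hlit).1]

/-- **Bob side**: `#{x ∈ Bset : sigB x = σ} − 2(2cos(π/15))^(n−m) ≤ 3·#cellB σ b` for every `σ` and every `b < 3`. -/
theorem three_mul_card_cellB_ge (hm : m ≤ n) (β : Fin s → Fin n → ZMod 5) (σ : Fin s → ZMod 5) {b : ℕ} (hb : b < 3) :
    (((Bset n m).filter fun x => sigB β m x = σ).card : ℝ) - 2 * (2 * Real.cos (Real.pi / 15)) ^ (n - m)
      ≤ 3 * ((cellB m (sigB β m) σ b).card : ℝ) := by
  have hcell : (cellB m (sigB β m) σ b).card = (univ.filter fun z : Fin (n - m) → Bool =>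
      ((univ.filter fun j => z j = true).card : ZMod 3) = (b : ZMod 3) ∧
      (fun k => ∑ j : Fin (n - m), if z j = true then β k (farIdx hm j) else 0) = σ).card := by
    have h := card_filter_Bset_sigB hm β σ (fun w => w % 3 = b)
    have e1 : cellB m (sigB β m) σ b = (Bset n m).filter fun x => sigB β m x = σ ∧ wtB m x % 3 = b := by
      ext x; simp [cellB]
    rw [e1, h]
    refine congrArg Finset.card (filter_congr fun z _ => ?_)
    rw [and_comm, wt, mod_three_eq_iff_cast _ hb]
  have hcls : ((Bset n m).filter fun x => sigB β m x = σ).card = (univ.filter fun z : Fin (n - m) → Bool =>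
      (fun k => ∑ j : Fin (n - m), if z j = true then β k (farIdx hm j) else 0) = σ).card := by
    have h := card_filter_Bset_sigB hm β σ (fun _ => True)
    simp only [and_true] at h
    exact h
  have hlit := TwoModuli.abs_three_mul_card_cell_sub_card_le (ι := Fin (n - m)) (p := 5) (K := s) (by norm_num)
    (fun k j => β k (farIdx hm j)) σ (b : ZMod 3)
  rw [two_cos_fifteen_eq, Fintype.card_fin, ← hcell, ← hcls] at hlit
  linarith [(abs_le.mp hlit).1]

end PerClass

/-! ### §4 The balance of a side: summing the smallest cells over all signatures -/

section Balance

variable {m s : ℕ}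

/-- **Alice balance**: `(2^m − 5^s·2(2cos(π/15))^m)/3 ≤ Σ_σ minCellA σ`. -/
theorem balanceA_ge (hm : m ≤ n) (α : Fin s → Fin n → ZMod 5) :
    ((2 : ℝ) ^ m - 5 ^ s * (2 * (2 * Real.cos (Real.pi / 15)) ^ m)) / 3
      ≤ ((∑ σ : Fin s → ZMod 5, minCellA m (sigA α m) σ : ℕ) : ℝ) := by
  set E : ℝ := 2 * (2 * Real.cos (Real.pi / 15)) ^ m with hE
  have hσ : ∀ σ : Fin s → ZMod 5,
      ((((Aset n m).filter fun v => sigA α m v = σ).card : ℝ) - E) / 3 ≤ (minCellA m (sigA α m) σ : ℝ) := by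
    intro σ
    unfold minCellA
    push_cast
    have h0 := three_mul_card_cellA_ge hm α σ (a := 0) (by norm_num)
    have h1 := three_mul_card_cellA_ge hm α σ (a := 1) (by norm_num)
    have h2 := three_mul_card_cellA_ge hm α σ (a := 2) (by norm_num)
    refine le_min (le_min ?_ ?_) ?_ <;> linarith
  have hsum : (∑ σ : Fin s → ZMod 5, (((Aset n m).filter fun v => sigA α m v = σ).card : ℝ)) = 2 ^ m := by
    have h := card_eq_sum_card_fiberwise (f := sigA α m) (s := Aset n m) (t := (univ : Finset (Fin s → ZMod 5)))
      (fun _ _ => mem_univ _)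
    rw [card_Aset hm] at h
    exact_mod_cast h.symm
  have hcard : (Fintype.card (Fin s → ZMod 5) : ℝ) = 5 ^ s := by
    rw [Fintype.card_fun, ZMod.card, Fintype.card_fin]; push_cast; ring
  calc ((2 : ℝ) ^ m - 5 ^ s * E) / 3
      = ∑ σ : Fin s → ZMod 5, ((((Aset n m).filter fun v => sigA α m v = σ).card : ℝ) - E) / 3 := by
        rw [← sum_div, sum_sub_distrib, hsum, sum_const, card_univ, nsmul_eq_mul, hcard]
    _ ≤ ∑ σ : Fin s → ZMod 5, (minCellA m (sigA α m) σ : ℝ) := sum_le_sum fun σ _ => hσ σ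
    _ = _ := by push_cast; rfl

/-- **Bob balance**: `(2^(n−m) − 5^s·2(2cos(π/15))^(n−m))/3 ≤ Σ_σ minCellB σ`. -/
theorem balanceB_ge (hm : m ≤ n) (β : Fin s → Fin n → ZMod 5) :
    ((2 : ℝ) ^ (n - m) - 5 ^ s * (2 * (2 * Real.cos (Real.pi / 15)) ^ (n - m))) / 3
      ≤ ((∑ σ : Fin s → ZMod 5, minCellB m (sigB β m) σ : ℕ) : ℝ) := by
  set E : ℝ := 2 * (2 * Real.cos (Real.pi / 15)) ^ (n - m) with hE
  have hσ : ∀ σ : Fin s → ZMod 5,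
      ((((Bset n m).filter fun x => sigB β m x = σ).card : ℝ) - E) / 3 ≤ (minCellB m (sigB β m) σ : ℝ) := by
    intro σ
    unfold minCellB
    push_cast
    have h0 := three_mul_card_cellB_ge hm β σ (b := 0) (by norm_num)
    have h1 := three_mul_card_cellB_ge hm β σ (b := 1) (by norm_num)
    have h2 := three_mul_card_cellB_ge hm β σ (b := 2) (by norm_num)
    refine le_min (le_min ?_ ?_) ?_ <;> linarith
  have hsum : (∑ σ : Fin s → ZMod 5, (((Bset n m).filter fun x => sigB β m x = σ).card : ℝ)) = 2 ^ (n - m) := by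
    have h := card_eq_sum_card_fiberwise (f := sigB β m) (s := Bset n m) (t := (univ : Finset (Fin s → ZMod 5)))
      (fun _ _ => mem_univ _)
    rw [card_Bset m] at h
    exact_mod_cast h.symm
  have hcard : (Fintype.card (Fin s → ZMod 5) : ℝ) = 5 ^ s := by
    rw [Fintype.card_fun, ZMod.card, Fintype.card_fin]; push_cast; ring
  calc ((2 : ℝ) ^ (n - m) - 5 ^ s * E) / 3
      = ∑ σ : Fin s → ZMod 5, ((((Bset n m).filter fun x => sigB β m x = σ).card : ℝ) - E) / 3 := by
        rw [← sum_div, sum_sub_distrib, hsum, sum_const, card_univ, nsmul_eq_mul, hcard]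
    _ ≤ ∑ σ : Fin s → ZMod 5, (minCellB m (sigB β m) σ : ℝ) := sum_le_sum fun σ _ => hσ σ
    _ = _ := by push_cast; rfl

end Balance

/-! ### §5 Numerics: `cos(π/15) ≤ 223/225`, and the balance is at least a quarter of the half-cube -/

/-- `cos(π/15) ≤ 1 − 2/225` (the quadratic bound `cos x ≤ 1 − 2x²/π²` on `[−π, π]`; no decimal expansion of `π`). -/
theorem cos_pi_div_fifteen_le : Real.cos (Real.pi / 15) ≤ 223 / 225 := by
  have hπ := Real.pi_pos
  have habs : |Real.pi / 15| ≤ Real.pi := by rw [abs_of_pos (by positivity)]; linarith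
  have h := Real.cos_le_one_sub_mul_cos_sq habs
  have e : 1 - 2 / Real.pi ^ 2 * (Real.pi / 15) ^ 2 = (223 / 225 : ℝ) := by
    field_simp
    ring
  linarith [h, e]

/-- `0 ≤ cos(π/15)`. -/
theorem cos_pi_div_fifteen_nonneg : 0 ≤ Real.cos (Real.pi / 15) :=
  Real.cos_nonneg_of_neg_pi_div_two_le_of_le (by linarith [Real.pi_pos]) (by linarith [Real.pi_pos])

/-- **the error term is small**: `5^s · 2(2cos(π/15))^L ≤ 2^L/4` once `240(s+1) ≤ L`. -/
theorem five_pow_mul_err_le {s L : ℕ} (hL : 240 * (s + 1) ≤ L) :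
    (5 : ℝ) ^ s * (2 * (2 * Real.cos (Real.pi / 15)) ^ L) ≤ 2 ^ L / 4 := by
  set c := Real.cos (Real.pi / 15) with hc
  have hc0 : 0 ≤ c := cos_pi_div_fifteen_nonneg
  have hc1 : c ≤ 223 / 225 := cos_pi_div_fifteen_le
  have h80 : c ^ 80 ≤ 1 / 2 := (pow_le_pow_left₀ hc0 hc1 80).trans (by norm_num)
  have hcL : c ^ L ≤ (1 / 2 : ℝ) ^ (3 * s + 3) := by
    calc c ^ L ≤ c ^ (80 * (3 * s + 3)) := pow_le_pow_of_le_one hc0 (hc1.trans (by norm_num)) (by omega)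
      _ = (c ^ 80) ^ (3 * s + 3) := pow_mul c 80 _
      _ ≤ (1 / 2 : ℝ) ^ (3 * s + 3) := pow_le_pow_left₀ (by positivity) h80 _
  have h58 : (5 : ℝ) ^ s * (1 / 2 : ℝ) ^ (3 * s + 3) ≤ 1 / 8 := by
    have e : (5 : ℝ) ^ s * (1 / 2 : ℝ) ^ (3 * s + 3) = (5 / 8 : ℝ) ^ s * (1 / 8) := by
      rw [pow_add, pow_mul, ← mul_assoc, ← mul_pow]; norm_num
    rw [e]
    have : (5 / 8 : ℝ) ^ s ≤ 1 := pow_le_one₀ (by norm_num) (by norm_num)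
    linarith
  have h2L : (0 : ℝ) ≤ 2 ^ L := by positivity
  calc (5 : ℝ) ^ s * (2 * (2 * c) ^ L) = 2 * 2 ^ L * (5 ^ s * c ^ L) := by rw [mul_pow]; ring
    _ ≤ 2 * 2 ^ L * (5 ^ s * (1 / 2 : ℝ) ^ (3 * s + 3)) := by gcongr
    _ ≤ 2 * 2 ^ L * (1 / 8) := by gcongr
    _ = 2 ^ L / 4 := by ring

/-- **ALICE BALANCE BOUND**: `2^m/4 ≤ Σ_σ minCellA σ` once `240(s+1) ≤ m`. -/
theorem balanceA_ge_quarter {m s : ℕ} (hm : m ≤ n) (hL : 240 * (s + 1) ≤ m) (α : Fin s → Fin n → ZMod 5) :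
    (2 : ℝ) ^ m / 4 ≤ ((∑ σ : Fin s → ZMod 5, minCellA m (sigA α m) σ : ℕ) : ℝ) := by
  have h1 := balanceA_ge hm α
  have h2 := five_pow_mul_err_le hL
  linarith

/-- **BOB BALANCE BOUND**: `2^(n−m)/4 ≤ Σ_σ minCellB σ` once `240(s+1) ≤ n − m`. -/
theorem balanceB_ge_quarter {m s : ℕ} (hm : m ≤ n) (hL : 240 * (s + 1) ≤ n - m) (β : Fin s → Fin n → ZMod 5) :
    (2 : ℝ) ^ (n - m) / 4 ≤ ((∑ σ : Fin s → ZMod 5, minCellB m (sigB β m) σ : ℕ) : ℝ) := by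
  have h1 := balanceB_ge hm β
  have h2 := five_pow_mul_err_le hL
  linarith

end Summit.QuantumAdvantage.AdviceFreeQNC0.OddConfig
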